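import Summits.ValiantsHypothesis.ValiantsHypothesis.Theorems.PolyaContinuedSignedCoverLittleTransfer
import Mathlib.GroupTheory.Perm.Cycle.Type
import HarnessLib

/-!
# Route PolyaContinued — support item `SignedCoverLittle` (stmt-ValiantsHypothesis-7426):
# the standard target `K_{3,3} ⊔ diagonal` (E-side facts for the H-side pipeline)

The lead's line `even_induction` (Cruxes/SignedCoverLittle/Lines) reduces the item to a label
identity onto a relabelling `relabel (kstd n) ρ κ` of the STANDARD TARGET `kstd n` = `K_{3,3}` on the
rows/columns `0, 1, 2` together with the diagonal cells `(i, i)`, `i ≥ 3`. After the H-side normal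
form (`…SignedCoverLittleNormalForm.lean`: the reference matching `κ ρ⁻¹` is moved to the diagonal)
the target becomes `relabel (kstd n) ρ ρ`, i.e. a graph of the shape

  `E_A = {(x, y) | (x ∈ A ∧ y ∈ A) ∨ x = y}`   (`K_{3,3}` on a `3`-set `A` of indices, plus the diagonal).

This file records, for any `E` of this shape (hypotheses `hE : ∀ x y, (x, y) ∈ E ↔ (x ∈ A ∧ y ∈ A)
∨ x = y`, `hA : A.card = 3`; no definition is introduced), the E-side facts consumed by the H-side
steps (F1) (`…TransferCircuits.lean`), (CS)/(EAR) and (EVEN):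

* `isPerfectMatching_iff_support_subset` — the perfect matchings of `E` are the permutations
  supported inside `A`; `card_filter_isPerfectMatching_eq_six` — there are exactly `6` of them;
* `isCycle_inv_mul_of_support_subset` — any two distinct ones differ by a single cycle (a
  non-identity permutation supported in a `3`-set is a transposition or a `3`-cycle), in particular
  every non-identity one is a dicircuit (`isCycle_of_support_subset`);
* `exists_common_moved_of_support_subset` — any two non-identity ones share a moved point;
* `exists_three_forks` — the two `3`-cycles on `A` are perfect matchings `δp ≠ δm` moving every
  point of `A` to different places: `3 ≤ #{x ∈ supp δp ∩ supp δm | δp x ≠ δm x}` (the count (T) of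
  `proof-LabelTransfer.md` for the unsubdivided target: three forks, no common arcs);
* bridges: `relabel_relabel_refl_symm_trans` (`relabel (relabel K ρ κ) 1 (κρ⁻¹)⁻¹ = relabel K ρ ρ`)
  and `mem_relabel_filter_kstd_iff` (the shape `E_A` of `relabel (kstd n) ρ ρ`, with
  `A = ρ {0, 1, 2}`, `card_filter_symm_lt_three`), stated on the defining filter of `kstd` so that
  they apply to the line's `kstd n` by `rfl`.
-/

namespace Summit.ValiantsHypothesis.PolyaContinued

open Finset Literature.Combinatorics.SimpleGraph Equiv

variable {n : ℕ}

/-! ### Perfect matchings of `K_{3,3} ⊔ diagonal` -/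

section Shape

variable {E : Finset (Fin n × Fin n)} {A : Finset (Fin n)}

/-- The perfect matchings of `E_A` are the permutations supported inside `A`. [folklore] -/
theorem isPerfectMatching_iff_support_subset
    (hE : ∀ x y, (x, y) ∈ E ↔ (x ∈ A ∧ y ∈ A) ∨ x = y) (π : Perm (Fin n)) :
    (∀ i, (i, π i) ∈ E) ↔ π.support ⊆ A := by
  constructor
  · intro h x hx
    rw [Perm.mem_support] at hx
    rcases (hE x (π x)).1 (h x) with h1 | h1
    · exact h1.1
    · exact absurd h1.symm hx
  · intro h i
    rw [hE]
    by_cases hi : π i = i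
    · exact Or.inr hi.symm
    · have hiA : i ∈ A := h (Perm.mem_support.2 hi)
      refine Or.inl ⟨hiA, h (Perm.mem_support.2 fun h' => hi (π.injective h'))⟩

/-- The diagonal lies inside `E_A`. [folklore] -/
theorem diag_mem_of_shape (hE : ∀ x y, (x, y) ∈ E ↔ (x ∈ A ∧ y ∈ A) ∨ x = y) (i : Fin n) :
    (i, i) ∈ E :=
  (hE i i).2 (Or.inr rfl)

/-- A non-identity permutation supported inside a set with three elements is a cyclic
permutation (a transposition or a `3`-cycle). [folklore] -/
theorem isCycle_of_support_subset_of_card (hA : A.card = 3) {θ : Perm (Fin n)}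
    (hθ : θ.support ⊆ A) (hne : θ ≠ 1) : θ.IsCycle := by
  have hle : θ.support.card ≤ 3 := hA ▸ Finset.card_le_card hθ
  have h0 : θ.support.card ≠ 0 := fun h => hne (Perm.card_support_eq_zero.1 h)
  have h1 : θ.support.card ≠ 1 := Perm.card_support_ne_one θ
  rcases Nat.lt_or_ge θ.support.card 3 with hlt | hge
  · have h2 : θ.support.card = 2 := by omega
    exact (Perm.card_support_eq_two.1 h2).isCycle
  · have h3 : θ.support.card = 3 := le_antisymm hle hge
    exact (_root_.card_support_eq_three_iff.1 h3).isCycle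

/-- **Any two distinct perfect matchings of `E_A` differ by a single alternating circuit**:
`π⁻¹ π'` is supported inside `A`, hence cyclic. [folklore] -/
theorem isCycle_inv_mul_of_support_subset (hA : A.card = 3) {π π' : Perm (Fin n)}
    (hπ : π.support ⊆ A) (hπ' : π'.support ⊆ A) (hne : π ≠ π') : (π⁻¹ * π').IsCycle := by
  refine isCycle_of_support_subset_of_card hA ?_ ?_
  · intro x hx
    have := Perm.support_mul_le _ _ hx
    rw [Finset.sup_eq_union, Finset.mem_union, Perm.support_inv] at this
    exact this.elim (fun h => hπ h) (fun h => hπ' h)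
  · intro h
    apply hne
    rw [inv_mul_eq_one] at h
    exact h

/-- Every non-identity perfect matching of `E_A` is a dicircuit. [folklore] -/
theorem isCycle_of_support_subset (hA : A.card = 3) {π : Perm (Fin n)} (hπ : π.support ⊆ A)
    (hne : π ≠ 1) : π.IsCycle :=
  isCycle_of_support_subset_of_card hA hπ hne

/-- **Any two non-identity perfect matchings of `E_A` share a moved point** (two subsets of size
`≥ 2` of a `3`-set meet). [folklore] -/
theorem exists_common_moved_of_support_subset (hA : A.card = 3) {π π' : Perm (Fin n)}
    (hπ : π.support ⊆ A) (hπ' : π'.support ⊆ A) (hne : π ≠ 1) (hne' : π' ≠ 1) :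
    ∃ a, π a ≠ a ∧ π' a ≠ a := by
  have h2 : 2 ≤ π.support.card := Perm.two_le_card_support_of_ne_one hne
  have h2' : 2 ≤ π'.support.card := Perm.two_le_card_support_of_ne_one hne'
  have hun : (π.support ∪ π'.support).card ≤ 3 :=
    hA ▸ Finset.card_le_card (Finset.union_subset hπ hπ')
  have hint : (π.support ∩ π'.support).Nonempty := by
    rw [← Finset.card_pos]
    have := Finset.card_union_add_card_inter π.support π'.support
    omega
  obtain ⟨a, ha⟩ := hint
  rw [Finset.mem_inter, Perm.mem_support, Perm.mem_support] at ha
  exact ⟨a, ha.1, ha.2⟩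

/-- **The perfect matchings of `E_A` are six**: they correspond to the permutations of the
`3`-set `A` (`Equiv.Perm.subtypeEquivSubtypePerm`). [folklore] -/
theorem card_filter_isPerfectMatching_eq_six
    (hE : ∀ x y, (x, y) ∈ E ↔ (x ∈ A ∧ y ∈ A) ∨ x = y) (hA : A.card = 3) :
    (Finset.univ.filter fun π : Perm (Fin n) => ∀ i, (i, π i) ∈ E).card = 6 := by
  classical
  have hset : (Finset.univ.filter fun π : Perm (Fin n) => ∀ i, (i, π i) ∈ E) =
      Finset.univ.filter fun π : Perm (Fin n) => ∀ a, ¬ (a ∈ A) → π a = a := by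
    ext π
    simp only [Finset.mem_filter, Finset.mem_univ, true_and, isPerfectMatching_iff_support_subset hE]
    constructor
    · intro h a ha
      by_contra hπa
      exact ha (h (Perm.mem_support.2 hπa))
    · intro h x hx
      by_contra hxA
      exact (Perm.mem_support.1 hx) (h x hxA)
  rw [hset]
  have hcard : (Finset.univ.filter fun π : Perm (Fin n) => ∀ a, ¬ (a ∈ A) → π a = a).card =
      Fintype.card {π : Perm (Fin n) // ∀ a, ¬ (a ∈ A) → π a = a} := by
    rw [Fintype.card_subtype]
  rw [hcard, ← Fintype.card_congr (Equiv.Perm.subtypeEquivSubtypePerm fun a => a ∈ A),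
    Fintype.card_perm, Fintype.card_coe, hA]
  rfl

/-- **Three forks.** `E_A` has two perfect matchings `δp ≠ δm`, both different from the identity
(the two `3`-cycles on `A`), which move every point of `A`, to different places:
`3 ≤ #{x ∈ supp δp ∩ supp δm | δp x ≠ δm x}` — the count (T) of the paper proof for the standard
target. [folklore] -/
theorem exists_three_forks (hE : ∀ x y, (x, y) ∈ E ↔ (x ∈ A ∧ y ∈ A) ∨ x = y) (hA : A.card = 3) :
    ∃ δp δm : Perm (Fin n), (∀ i, (i, δp i) ∈ E) ∧ (∀ i, (i, δm i) ∈ E) ∧ δp ≠ 1 ∧ δm ≠ 1 ∧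
      δp ≠ δm ∧ 3 ≤ ((δp.support ∩ δm.support).filter fun x => δp x ≠ δm x).card := by
  classical
  obtain ⟨a, b, c, hab, hac, hbc, hAeq⟩ := Finset.card_eq_three.1 hA
  -- the `3`-cycle `a ↦ b ↦ c ↦ a` and its inverse
  set δ : Perm (Fin n) := swap a b * swap b c with hδ
  have hδa : δ a = b := by
    rw [hδ, Perm.mul_apply, swap_apply_of_ne_of_ne hab hac, swap_apply_left]
  have hδb : δ b = c := by
    rw [hδ, Perm.mul_apply, swap_apply_left, swap_apply_of_ne_of_ne hac.symm hbc.symm]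
  have hδc : δ c = a := by
    rw [hδ, Perm.mul_apply, swap_apply_right, swap_apply_right]
  have hδfix : ∀ x, x ∉ A → δ x = x := by
    intro x hx
    rw [hAeq] at hx
    simp only [Finset.mem_insert, Finset.mem_singleton, not_or] at hx
    rw [hδ, Perm.mul_apply, swap_apply_of_ne_of_ne hx.2.1 hx.2.2, swap_apply_of_ne_of_ne hx.1 hx.2.1]
  have hδsupp : δ.support ⊆ A := by
    intro x hx
    by_contra hxA
    exact (Perm.mem_support.1 hx) (hδfix x hxA)
  have hδ2a : (δ * δ) a = c := by rw [Perm.mul_apply, hδa, hδb]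
  have hδ2b : (δ * δ) b = a := by rw [Perm.mul_apply, hδb, hδc]
  have hδ2c : (δ * δ) c = b := by rw [Perm.mul_apply, hδc, hδa]
  have hδ2supp : (δ * δ).support ⊆ A := fun x hx => by
    have := Perm.support_mul_le _ _ hx
    rw [Finset.sup_eq_union, Finset.union_idempotent] at this
    exact hδsupp this
  refine ⟨δ, δ * δ, (isPerfectMatching_iff_support_subset hE δ).2 hδsupp,
    (isPerfectMatching_iff_support_subset hE (δ * δ)).2 hδ2supp, ?_, ?_, ?_, ?_⟩
  · intro h
    have := congrArg (fun g : Perm (Fin n) => g a) h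
    simp only [hδa, Perm.coe_one, id_eq] at this
    exact hab this.symm
  · intro h
    have := congrArg (fun g : Perm (Fin n) => g a) h
    simp only [hδ2a, Perm.coe_one, id_eq] at this
    exact hac this.symm
  · intro h
    have := congrArg (fun g : Perm (Fin n) => g a) h
    rw [hδa, hδ2a] at this
    exact hbc this
  · have hsub : ({a, b, c} : Finset (Fin n)) ⊆
        (δ.support ∩ (δ * δ).support).filter fun x => δ x ≠ (δ * δ) x := by
      intro x hx
      simp only [Finset.mem_insert, Finset.mem_singleton] at hx
      rw [Finset.mem_filter, Finset.mem_inter, Perm.mem_support, Perm.mem_support]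
      rcases hx with rfl | rfl | rfl
      · rw [hδa, hδ2a]; exact ⟨⟨hab.symm, hac.symm⟩, hbc⟩
      · rw [hδb, hδ2b]; exact ⟨⟨hbc.symm, hab⟩, hac.symm⟩
      · rw [hδc, hδ2c]; exact ⟨⟨hac, hbc⟩, hab⟩
    calc 3 = ({a, b, c} : Finset (Fin n)).card := by rw [← hAeq, hA]
      _ ≤ _ := Finset.card_le_card hsub

end Shape

/-! ### Bridges from the line's standard target -/

/-- Moving the reference matching `κ ρ⁻¹` of `relabel K ρ κ` to the diagonal gives the symmetric
relabelling `relabel K ρ ρ`. [folklore] -/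
theorem relabel_relabel_refl_symm_trans (K : Finset (Fin n × Fin n)) (ρ κ : Perm (Fin n)) :
    relabel (relabel K ρ κ) (Equiv.refl _) (ρ.symm.trans κ).symm = relabel K ρ ρ := by
  ext ⟨x, y⟩
  simp only [mem_relabel_iff, Equiv.symm_symm, Equiv.refl_symm, Equiv.refl_apply,
    Equiv.trans_apply, Equiv.symm_apply_apply]

/-- For `n ≥ 3`, the indices `x` with `ρ⁻¹ x < 3` are three. [folklore] -/
theorem card_filter_symm_lt_three (ρ : Perm (Fin n)) (hn : 3 ≤ n) :
    (Finset.univ.filter fun x : Fin n => ((ρ.symm x : Fin n) : ℕ) < 3).card = 3 := by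
  classical
  have h1 : (Finset.univ.filter fun x : Fin n => ((ρ.symm x : Fin n) : ℕ) < 3) =
      (Finset.univ.filter fun i : Fin n => (i : ℕ) < 3).map ρ.toEmbedding := by
    ext x
    simp only [Finset.mem_filter, Finset.mem_univ, true_and, Finset.mem_map_equiv]
  rw [h1, Finset.card_map]
  -- the indices `< 3` of `Fin n` are the image of `Fin 3`
  have h2 : (Finset.univ.filter fun i : Fin n => (i : ℕ) < 3) =
      Finset.univ.map (Fin.castLEEmb hn) := by
    ext i
    simp only [Finset.mem_filter, Finset.mem_univ, true_and, Finset.mem_map,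
      Fin.coe_castLEEmb]
    constructor
    · intro hi
      exact ⟨⟨i, hi⟩, Fin.ext rfl⟩
    · rintro ⟨j, rfl⟩
      exact j.2
  rw [h2, Finset.card_map, Finset.card_univ, Fintype.card_fin]

/-- **The shape of the normalised standard target.** For the standard target given by its defining
filter (`kstd n` of the line `even_induction`: cells `(a, b)` with `a, b < 3` or `a = b ≥ 3`),
`relabel (kstd n) ρ ρ` is `K_{3,3}` on `A = {x | ρ⁻¹ x < 3}` plus the diagonal. [folklore] -/
theorem mem_relabel_filter_kstd_iff (ρ : Perm (Fin n)) (x y : Fin n) :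
    (x, y) ∈ relabel (Finset.univ.filter fun e : Fin n × Fin n =>
        ((e.1 : ℕ) < 3 ∧ (e.2 : ℕ) < 3) ∨ (e.1 = e.2 ∧ 3 ≤ (e.1 : ℕ))) ρ ρ ↔
      (x ∈ (Finset.univ.filter fun x : Fin n => ((ρ.symm x : Fin n) : ℕ) < 3) ∧
        y ∈ (Finset.univ.filter fun x : Fin n => ((ρ.symm x : Fin n) : ℕ) < 3)) ∨ x = y := by
  rw [mem_relabel_iff]
  simp only [Finset.mem_filter, Finset.mem_univ, true_and]
  constructor
  · rintro (h | ⟨h1, -⟩)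
    · exact Or.inl h
    · exact Or.inr (ρ.symm.injective h1)
  · rintro (h | rfl)
    · exact Or.inl h
    · by_cases hx : ((ρ.symm x : Fin n) : ℕ) < 3
      · exact Or.inl ⟨hx, hx⟩
      · exact Or.inr ⟨rfl, not_lt.1 hx⟩

end Summit.ValiantsHypothesis.PolyaContinued
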